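import Summits.CriticalPhenomena.PercolationContinuityZ3.Theorems.PercNearOneGluingNoHeavyLowerTailMajorityGluingHubOnly
import HarnessLib

/-!
# Majority gluing with loss `2·max` from the WEAK (ballot-type) percolation Erdős–Ko–Rado bound
# (lane prim-rate, constants-miner 1, rows M1-L2 ⇐ M1-H1 ⇐ M1-E1w)

Support file for the closed crux `NoHeavyLowerTail` (stmt-CriticalPhenomena-4575), continuing
`PercNearOneGluingNoHeavyLowerTailMajorityGluingHubOnly.lean` (the hub-only reduction `HubOnly.majorityGluing_of_hubOnly`).
There, `HubOnly.majorityGluing_two_of_percEKR` derives majority gluing with loss `2·max_{a∈A} μ(a ↮ a₀)` for EVERY `|A|` from the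
percolation Erdős–Ko–Rado bound `μ(#cut ≥ h) ≤ max_v μ(v ↮ a₀)` (marginals `≤ 1/2`, `|T| < 2h`).  Here the SAME conclusion is obtained from
the WEAKER ballot-type bound `μ(#cut ≥ h) ≤ δ/(1 − δ)` at marginals `≤ δ ≤ 1/2` (row M1-E1w of
`run/shared/lean/prim/prim-rate/prim-rate-mine-1/CANDIDATES.md` §GEN-2) — for independent cuts this is Frankl's shifted random-walk bound
`μ_p(𝓕) ≤ p/(1−p)` for intersecting families, which has a two-line proof, whereas the sharp `μ_p(𝓕) ≤ p` is the biased EKR theorem.  The gain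
comes from Harris' inequality applied to `{a ↔ a₀} ∩ {#cut ≥ h}` (increasing × decreasing): `μ(H_a) ≤ δ_a + (1 − δ_a)·δ/(1−δ) ≤ 2δ`.
This is the weakest hub-only input that gives the conjectured constant `2` (row M1-L2) for all `|A|`; the first open instance is
`|T| = 4, h = 3` (`|A| = 6`).  Also recorded: the CONVERSE of the reduction (`HubOnly.deficit_eq_hubEvent_of_mem`: the observer `o := a`
realises `μ(H_a)` exactly), so rows M1-L2(C) and M1-H1(C) are equivalent constant for constant.  No definitions, no named facts, no sorries. [cite: KozmaNitzan2024, Conj. 1 (p. 3), Conj. 4 (p. 32)]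
-/

noncomputable section

namespace Summit.CriticalPhenomena.PercolationContinuityZ3.Theorems

open MeasureTheory Set
open Literature.Probability.LatticeModels (prodBernoulli)
open Literature.Probability.Percolation
open scoped Classical

namespace HubOnly

variable {n : ℕ}

/-- The threshold cut event `{h ≤ #{v ∈ T : v ↮ a₀}}` is decreasing. [folklore] -/
theorem isLowerSet_thresholdCut (T : Finset (Fin n)) (a₀ : Fin n) (h : ℕ) :
    IsLowerSet {ω : BondConfig (Fin n) | h ≤ (T.filter fun v => ω ∉ openConn v a₀).card} := by
  intro ω ω' hle hω
  refine le_trans hω (Finset.card_le_card fun v hv => ?_)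
  rw [Finset.mem_filter] at hv ⊢
  exact ⟨hv.1, fun h' => hv.2 (isUpperSet_openConn v a₀ hle h')⟩

/-- **MAJORITY GLUING WITH LOSS `2·max` FOR EVERY `|A|`, FROM THE WEAK (BALLOT-TYPE) PERCOLATION EKR BOUND** — the weakest hub-only input
that suffices (prim-rate row M1-E1w).  HYPOTHESIS (non-degenerate weights): for a hub `a₀ ∉ T`, `|T| < 2h`, `δ ≤ 1/2` and `μ(v ↮ a₀) ≤ δ` on `T`,
`μ(h ≤ #{v ∈ T : v ↮ a₀}) ≤ δ/(1 − δ)` — for INDEPENDENT cuts this is Frankl's shifted random-walk (ballot) bound `μ_p(𝓕) ≤ p/(1−p)` for an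
intersecting family, weaker than the biased Erdős–Ko–Rado bound `p`.  CONCLUSION: `μ(o ↔ a₀ ∧ 2N > |A|) ≥ μ(o ↔ A) − 2·max_{a∈A} μ(a ↮ a₀)` for every
relay set, hub, observer and weight function.  Proof: with `M = max`, if `M > 1/2` the bound is trivial; otherwise
`H_a ⊆ {a ↮ a₀} ∪ ({a ↔ a₀} ∩ {h ≤ #cut(A ∖ {a₀,a})})`, Harris (increasing × decreasing) bounds the second piece by `(1 − δ_a)·M/(1−M)`, and
`δ_a + (1 − δ_a)·M/(1−M) ≤ M + (1−M)·M/(1−M) = 2M`. [cite: KozmaNitzan2024, Conj. 1 (p. 3), Conj. 4 (p. 32)] -/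
theorem majorityGluing_two_of_weakPercEKR
    (hWEKR : ∀ (n : ℕ) (p : Sym2 (Fin n) → unitInterval), (∀ e, 0 < p e ∧ p e < 1) →
      ∀ (T : Finset (Fin n)) (a₀ : Fin n) (h : ℕ) (δ : ℝ), a₀ ∉ T → T.card < 2 * h → δ ≤ 1 / 2 →
      (∀ v ∈ T, (prodBernoulli p).real (openConn v a₀ : Set (BondConfig (Fin n)))ᶜ ≤ δ) →
      (prodBernoulli p).real {ω : BondConfig (Fin n) | h ≤ (T.filter fun v => ω ∉ openConn v a₀).card} ≤ δ / (1 - δ))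
    (n : ℕ) (w : Sym2 (Fin n) → unitInterval) (A : Finset (Fin n)) (o a₀ : Fin n) (δ₀ : ℝ)
    (ha₀ : a₀ ∈ A) (hδ₀ : ∀ a ∈ A, (prodBernoulli w).real (openConn a a₀ : Set (BondConfig (Fin n)))ᶜ ≤ δ₀) :
    (prodBernoulli w).real (⋃ a ∈ A, openConn o a) - 2 * δ₀ ≤
      (prodBernoulli w).real {ω : BondConfig (Fin n) | ω ∈ openConn o a₀ ∧
          A.card < 2 * (A.filter fun a => ω ∈ openConn o a).card} := by
  have h := majorityGluing_of_hubOnly (n := n) 2 zero_le_two A a₀ ha₀ ?_ w o δ₀ hδ₀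
  · linarith
  intro p hp a ha
  set μ := prodBernoulli p with hμ
  have hms : ∀ S : Set (BondConfig (Fin n)), MeasurableSet S := fun _ => MeasurableSet.of_discrete
  set δ : Fin n → ℝ := fun x => μ.real (openConn x a₀ : Set (BondConfig (Fin n)))ᶜ with hδ
  set M := A.sup' ⟨a₀, ha₀⟩ δ with hM
  have hδle : ∀ x ∈ A, δ x ≤ M := fun x hx => Finset.le_sup' δ hx
  have hM0 : 0 ≤ M := le_trans measureReal_nonneg (hδle a₀ ha₀)
  set H : Set (BondConfig (Fin n)) := {ω | ω ∈ openConn a a₀ →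
      2 * (A.filter fun a' => ω ∈ openConn a' a₀).card ≤ A.card} with hH
  by_cases hbig : 1 / 2 < M
  · have : μ.real H ≤ 1 := measureReal_le_one
    linarith
  have hbig' : M ≤ 1 / 2 := not_lt.1 hbig
  set T : Finset (Fin n) := (A.erase a₀).erase a with hT
  set hh : ℕ := (A.card + 1) / 2 with hhh
  have hTA : T ⊆ A := (Finset.erase_subset _ _).trans (Finset.erase_subset _ _)
  have ha₀T : a₀ ∉ T := fun h' => Finset.ne_of_mem_erase (Finset.mem_of_mem_erase h') rfl |>.elim
  set K : Set (BondConfig (Fin n)) := {ω | hh ≤ (T.filter fun v => ω ∉ openConn v a₀).card} with hK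
  -- `H ⊆ {a ↮ a₀} ∪ ({a ↔ a₀} ∩ K)`
  have hsub : H ⊆ (openConn a a₀ : Set (BondConfig (Fin n)))ᶜ ∪ ((openConn a a₀ : Set (BondConfig (Fin n))) ∩ K) := by
    intro ω hω
    by_cases haa : ω ∈ openConn a a₀
    · right
      refine ⟨haa, ?_⟩
      have hle := hω haa
      have hsplit := Finset.card_filter_add_card_filter_not (s := A) (fun a' => ω ∈ openConn a' a₀)
      have hcut : (A.filter fun a' => ω ∉ openConn a' a₀) ⊆ T.filter fun v => ω ∉ openConn v a₀ := by
        intro x hx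
        rw [Finset.mem_filter] at hx ⊢
        refine ⟨?_, hx.2⟩
        rw [hT, Finset.mem_erase, Finset.mem_erase]
        refine ⟨?_, ?_, hx.1⟩
        · rintro rfl; exact hx.2 haa
        · rintro rfl; exact hx.2 (SimpleGraph.Reachable.refl _ : (openGraph ω).Reachable x x)
      have hc := Finset.card_le_card hcut
      simp only [hK, mem_setOf_eq]
      omega
    · left; exact haa
  have hTcard : T.card < 2 * hh := by
    have h1 : T.card + 1 ≤ A.card := by
      have e1 := Finset.card_erase_of_mem ha₀
      have h2 : T.card ≤ (A.erase a₀).card := Finset.card_le_card (Finset.erase_subset _ _)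
      have hk : 1 ≤ A.card := Finset.card_pos.2 ⟨a₀, ha₀⟩
      omega
    have hk2 : A.card ≤ 2 * hh := by rw [hhh]; omega
    omega
  -- the weak EKR bound for `K`, and Harris for `{a ↔ a₀} ∩ K`
  have hKb : μ.real K ≤ M / (1 - M) :=
    hWEKR n p hp T a₀ hh M ha₀T hTcard hbig' (fun v hv => hδle v (hTA hv))
  have hHarris : μ.real ((openConn a a₀ : Set (BondConfig (Fin n))) ∩ K) ≤
      μ.real (openConn a a₀ : Set (BondConfig (Fin n))) * μ.real K :=
    Literature.Probability.LatticeModels.prodBernoulli_harris_upper_lower p (isUpperSet_openConn a a₀)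
      (isLowerSet_thresholdCut T a₀ hh) (hms _) (hms _)
  have hconn : μ.real (openConn a a₀ : Set (BondConfig (Fin n))) = 1 - δ a := by
    have := probReal_compl_eq_one_sub (μ := μ) (hms (openConn a a₀ : Set (BondConfig (Fin n))))
    simp only [hδ]; linarith
  have hδa : δ a ≤ M := hδle a ha
  have hδa0 : 0 ≤ δ a := measureReal_nonneg
  have hK0 : 0 ≤ μ.real K := measureReal_nonneg
  have hB1 : M / (1 - M) ≤ 1 := by
    rw [div_le_one (by linarith)]; linarith
  have h1M : 0 < 1 - M := by linarith
  -- `(1 - M) · (M/(1-M)) = M`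
  have hMid : (1 - M) * (M / (1 - M)) = M := by field_simp
  calc μ.real H ≤ μ.real ((openConn a a₀ : Set (BondConfig (Fin n)))ᶜ ∪ ((openConn a a₀ : Set (BondConfig (Fin n))) ∩ K)) :=
        measureReal_mono hsub
    _ ≤ μ.real (openConn a a₀ : Set (BondConfig (Fin n)))ᶜ + μ.real ((openConn a a₀ : Set (BondConfig (Fin n))) ∩ K) :=
        measureReal_union_le _ _
    _ ≤ δ a + (1 - δ a) * μ.real K := by rw [← hconn]; exact add_le_add le_rfl hHarris
    _ ≤ δ a + (1 - δ a) * (M / (1 - M)) := by nlinarith [hKb, hδa, hbig']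
    _ ≤ M + (1 - M) * (M / (1 - M)) := by nlinarith [hB1, hδa, hM0, hK0]
    _ = 2 * M := by rw [hMid]; ring


/-- **The converse of the hub-only reduction: the observer `o := a` realises `μ(H_a)`.**  For `a ∈ A`:
`μ(a ↔ A) − μ(a ↔ a₀ ∧ 2·#{a' ∈ A : a ↔ a'} > |A|) = μ(a ↔ a₀ → 2·#{a' ∈ A : a' ↔ a₀} ≤ |A|)`,
so every lower bound `C·max` for majority gluing over all observers is a bound `μ(H_a) ≤ C·max`, and every violation of the hub-only bound
(prim-rate row M1-H1) is a violation of majority gluing (row M1-L2) with the observer placed at the relay `a`: the two rows are EQUIVALENT,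
constant for constant (with `HubOnly.majorityGluing_of_hubOnly`). [cite: KozmaNitzan2024, Conj. 1 (p. 3)] -/
theorem deficit_eq_hubEvent_of_mem (w : Sym2 (Fin n) → unitInterval) (A : Finset (Fin n)) (a₀ a : Fin n) (ha : a ∈ A) :
    (prodBernoulli w).real (⋃ a' ∈ A, openConn a a') -
        (prodBernoulli w).real {ω : BondConfig (Fin n) | ω ∈ openConn a a₀ ∧
          A.card < 2 * (A.filter fun a' => ω ∈ openConn a a').card}
      = (prodBernoulli w).real {ω : BondConfig (Fin n) | ω ∈ openConn a a₀ →
          2 * (A.filter fun a' => ω ∈ openConn a' a₀).card ≤ A.card} := by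
  set μ := prodBernoulli w with hμ
  have hms : ∀ S : Set (BondConfig (Fin n)), MeasurableSet S := fun _ => MeasurableSet.of_discrete
  -- `{a ↔ A}` is everything since `a ∈ A`
  have hU : (⋃ a' ∈ A, (openConn a a' : Set (BondConfig (Fin n)))) = Set.univ := by
    refine Set.eq_univ_of_forall fun ω => mem_biUnion (Finset.mem_coe.2 ha) ?_
    exact (SimpleGraph.Reachable.refl _ : (openGraph ω).Reachable a a)
  -- the majority event is the complement of the hub event
  have hC : {ω : BondConfig (Fin n) | ω ∈ openConn a a₀ ∧ A.card < 2 * (A.filter fun a' => ω ∈ openConn a a').card} =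
      {ω : BondConfig (Fin n) | ω ∈ openConn a a₀ → 2 * (A.filter fun a' => ω ∈ openConn a' a₀).card ≤ A.card}ᶜ := by
    ext ω
    simp only [mem_setOf_eq, mem_compl_iff, Classical.not_imp, not_le]
    constructor
    · rintro ⟨h0, hc⟩
      refine ⟨h0, ?_⟩
      have hfilt : (A.filter fun a' => ω ∈ openConn a a') = (A.filter fun a' => ω ∈ openConn a' a₀) := by
        refine Finset.filter_congr fun a' _ => ?_
        change (openGraph ω).Reachable a a' ↔ (openGraph ω).Reachable a' a₀
        have haa : (openGraph ω).Reachable a a₀ := h0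
        exact ⟨fun h => h.symm.trans haa, fun h => haa.trans h.symm⟩
      rwa [hfilt] at hc
    · rintro ⟨h0, hc⟩
      refine ⟨h0, ?_⟩
      have hfilt : (A.filter fun a' => ω ∈ openConn a a') = (A.filter fun a' => ω ∈ openConn a' a₀) := by
        refine Finset.filter_congr fun a' _ => ?_
        change (openGraph ω).Reachable a a' ↔ (openGraph ω).Reachable a' a₀
        have haa : (openGraph ω).Reachable a a₀ := h0
        exact ⟨fun h => h.symm.trans haa, fun h => haa.trans h.symm⟩
      rwa [hfilt]
  rw [hU, hC, probReal_univ, probReal_compl_eq_one_sub (hms _)]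
  ring

end HubOnly

end Summit.CriticalPhenomena.PercolationContinuityZ3.Theorems

end
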